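import Summits.BirchSwinnertonDyer.BirchSwinnertonDyer.Theorems.PrintCf2RamifiedOffTYZMoverChainsEven
import HarnessLib

/-!
# Crux `PrintCf2.RamifiedOffTYZOfFacts` (stmt-BirchSwinnertonDyer-20509), line `offtyz-v7`, LEAD cycle 9 (cruxlead-20509 g8):
# THEOREM B ON EVERY CM BLOCK (`d ≡ 5` AND `d ≡ 6 (mod 8)`) AND THE GENUS POINT OF AN EVEN `n ≡ 6 (mod 8)` UNDER A SQUARE

THEOREMS ONLY (no `def`, no named fact, no `sorry`), `--supports stmt-BirchSwinnertonDyer-20509`; steps (E2)/(E4) of the even mover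
programme (crux workfile `Lines/offtyz_v7_SevenSector.md` §8) in ABSTRACT form — the class condition of a block `d ≡ 6 (mod 8)` is left
as the membership `(g·g)^{g(d)} σ_d⁻¹ ∈ Gal(ℍ′_n/H′_d)` (its dictionary with `Pic`/ray classes of `ℚ(√−d)` is typer work, asked).

* §1 **THEOREM B at layer 1 on EVERY CM block** (`galPt_genusPeriod_dichotomy_of_cmBlockSpec_all`): ty2's dichotomy
  `galPt_genusPeriod_dichotomy_of_cmBlockSpec` (p672887 ff.) assumed `d ≡ 5 (mod 8)` — it ran the abstract THEOREM B (`galPt_sum_dichotomy`)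
  on `Q = Gal(ℍ′_n/L_d(i))`, and `Gal(ℍ′_n/H_d) ≤ Q` needs `L_d(i) = L_d`, false for `d ≡ 6`.  Here the abstract theorem is run instead on
  the COSET SPACE `Q := {x : x(√−d) = √−d, x ∈ Φ₀·⟨σ⟩·Gal(ℍ′_n/H′_d)}` — a subgroup because `K_d`-automorphisms commute modulo
  `Gal(ℍ′_n/H′_d)` ((G3)) and `Φ₀·⟨σ⟩` represents every `L_d(i)`-trivial element ((G7)); it contains `Gal(ℍ′_n/H′_d)`, `σ`, `Φ₀` and every
  `L_d(i)`-trivial `g` with NO parity hypothesis on `d`.  Hence for every block with `CMBlockSpec` (so `d ≡ 5` or `6`) and every `g` trivial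
  on `L_d(i)`: `g^{g(d)} ∈ Gal(ℍ′_n/H′_d) ∧ g·Z(d) = Z(d)` or `g^{g(d)} σ⁻¹ ∈ Gal(ℍ′_n/H′_d) ∧ g·Z(d) = Z(d) + τ(1)`; the mover criterion
  `galPt_genusPeriod_ne_iff_of_cmBlockSpec_all`.
* §2 **Unified block law for squares on every CM block** (`galPt_mul_self_Z_eq_add_ite_all`):
  `g·g·Z(d) = Z(d) + [g(√−d) = √−d ∧ (g·g)^{g(d)} σ⁻¹ ∈ Gal(ℍ′_n/H′_d)]·τ(1)` (g7's `galPt_mul_self_Z_eq_add_ite` without `d ≡ 5`).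
* §3 **The genus point of an even square-free `n ≡ 6 (mod 8)` under a square** (`galPt_mul_self_P_eq_add_even`, `galPt_mul_self_P_ne_iff_even`):
  with `ι(d) := [(d ≡ 5 ∨ d ≡ 6) ∧ g(√−d) = √−d ∧ (g·g)^{g(d)} σ_d⁻¹ ∈ Gal(ℍ′_n/H′_d)]`,
  `g·g·P(n) = P(n) + (ι(n) + Σ_{d ∈ R(n)} |𝓛(n/d)| ι(d) + Σ_{d ∈ R(n)} Σ_{d′ ∈ R(d), d′ ≡ 5} |𝓛(n/d)||𝓛(d/d′)| ι(d′)
  + Σ_{d ∈ R(n) even} Σ_{d′ ∈ R(d)} Σ_{e ∈ R(d′), e ≡ 5} |𝓛(n/d)||𝓛(d/d′)||𝓛(d′/e)| ι(e))·τ(1)` (`R = recursionIndex`; the even Möbius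
  inversion `galPt_P_eq_add_moebius_even` of the previous file), and `g·g` MOVES `P(n)` iff that integer is odd — the input of the even
  Galois-mover door `GaloisMotion.rankOne_sha_bsdp_two_congruentNumberCurve_of_selmerEight_of_mover_even` (p677864).
BSD is not proved by any of this; no class is closed by this file.

References: [cite: TianYuanZhang2017, §3.1 (p0010 L104–L115, p0011 L1–L13, L53–L73), Prop. 3.2 (1)(2), Thm. 3.6 (1)(2) (p0012 L22–L36),
proof of Lemma 3.15 (J750), proof of Lemma 3.21 (p0020 L50–L63)]; [cite: Cox2013, Lemma 9.3]; crux notes `Lines/offtyz_v7_TransferLayer.md` §3,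
`Lines/offtyz_v7_SevenSector.md` §8.
-/

noncomputable section

open scoped Classical

open WeierstrassCurve WeierstrassCurve.Affine Finset Literature.NumberTheory.EllipticCurves
  Literature.NumberTheory.EllipticCurves.TianYuanZhang2017
  Literature.NumberTheory.EllipticCurves.TianYuanZhang2017.W2
  Summit.BirchSwinnertonDyer.Rank1Residual.P2.GenusPeriodTransferLayer
  Summit.BirchSwinnertonDyer.Rank1Residual.P2.ThetaDescent

set_option autoImplicit false

namespace Summit.BirchSwinnertonDyer.PrintCf2.MoverAssembly

variable {n : ℕ} (D : GenusPointData n)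

/-! ## §1 THEOREM B at layer 1 on every CM block -/

/-- **THEOREM B AT LAYER 1 on EVERY block of the CM-point display** (`d ≡ 5` or `6 (mod 8)`; no parity hypothesis is used): for
`D.CMBlockSpec d z Φ ΓH ΓH' σ c` and EVERY automorphism `g` of `ℍ′_n` trivial on `L_d(i)`, either `g^{g(d)} ∈ Gal(ℍ′_n/H′_d)` and
`g·Z(d) = Z(d)`, or `g^{g(d)} σ⁻¹ ∈ Gal(ℍ′_n/H′_d)` and `g·Z(d) = Z(d) + τ(1)`.  The abstract THEOREM B (`galPt_sum_dichotomy`) run on the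
coset space `Φ₀·⟨σ⟩·Gal(ℍ′_n/H′_d)` inside the `√−d`-fixing automorphisms (a subgroup by (G3) and (G7)).
[cite: TianYuanZhang2017, §3.1 (p0011 L1–L13, L53–L58), Prop. 3.2 (1)(2) (p0010 L108–L113), Thm. 3.6 (1)(2) (p0012 L27–L33), proof of Lemma 3.21 (p0020 L55–L62)] -/
theorem galPt_genusPeriod_dichotomy_of_cmBlockSpec_all {d : ℕ} (hd1 : 1 < d)
    {z : APoint D.H} {Φ : Finset (D.H ≃ₐ[ℚ] D.H)} {ΓH ΓH' : Subgroup (D.H ≃ₐ[ℚ] D.H)} {σ c : D.H ≃ₐ[ℚ] D.H}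
    (h : D.CMBlockSpec d z Φ ΓH ΓH' σ c) {g : D.H ≃ₐ[ℚ] D.H} (hg : D.TrivialOnL d g) :
    (g ^ gK d ∈ ΓH' ∧ D.galPt g (D.Z d) = D.Z d) ∨
    (g ^ gK d * σ⁻¹ ∈ ΓH' ∧ D.galPt g (D.Z d) = D.Z d + tauOne) := by
  obtain ⟨⟨hZ, hcard⟩, hΦL, ⟨hΓz, hΓn, hcomm⟩, ⟨hΓ'Γ, hΓfix⟩, -, ⟨hσΓ, hσσ, hσz⟩, hrep, huniq⟩ := h
  have hdd : d ∈ d.divisors := Nat.mem_divisors_self d (by omega)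
  -- "fixes `√−d`"
  have hK : ∀ x : D.H ≃ₐ[ℚ] D.H, D.TrivialOnL d x → x (D.sqrtNeg d) = D.sqrtNeg d := fun x hx => hx.2 d hdd hd1
  have hΓK : ∀ γ ∈ ΓH', γ (D.sqrtNeg d) = D.sqrtNeg d := fun γ hγ => (hΓfix γ (hΓ'Γ γ hγ)).1
  have hσK : σ (D.sqrtNeg d) = D.sqrtNeg d := (hΓfix σ hσΓ).1
  -- the quotient by the normal subgroup `Γ = Gal(ℍ′_n/H′_d)`
  haveI hN : ΓH'.Normal := ⟨fun γ hγ x => hΓn x γ hγ⟩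
  obtain ⟨φ, hφ⟩ : ∃ φ : (D.H ≃ₐ[ℚ] D.H) →* (D.H ≃ₐ[ℚ] D.H) ⧸ ΓH', φ = QuotientGroup.mk' ΓH' := ⟨_, rfl⟩
  have hφmem : ∀ x y : D.H ≃ₐ[ℚ] D.H, x * y⁻¹ ∈ ΓH' ↔ φ x = φ y := by
    intro x y
    rw [hφ, QuotientGroup.mk'_apply, QuotientGroup.mk'_apply, QuotientGroup.eq_iff_div_mem, div_eq_mul_inv]
  have hφone : ∀ γ : D.H ≃ₐ[ℚ] D.H, γ ∈ ΓH' → φ γ = 1 := by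
    intro γ hγ
    rw [hφ, QuotientGroup.mk'_apply, QuotientGroup.eq_one_iff]
    exact hγ
  have hφcomm : ∀ s t : D.H ≃ₐ[ℚ] D.H, s (D.sqrtNeg d) = D.sqrtNeg d → t (D.sqrtNeg d) = D.sqrtNeg d →
      φ s * φ t = φ t * φ s := by
    intro s t hs ht
    have h1 : φ (s⁻¹ * t⁻¹ * s * t) = 1 := hφone _ (hcomm s t hs ht)
    rw [map_mul, map_mul, map_mul, map_inv, map_inv] at h1
    calc φ s * φ t = φ t * φ s * ((φ s)⁻¹ * (φ t)⁻¹ * φ s * φ t) := by group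
      _ = φ t * φ s := by rw [h1, mul_one]
  have hSS : φ σ * φ σ = 1 := by rw [← map_mul]; exact hφone _ hσσ
  have hSinv : (φ σ)⁻¹ = φ σ := inv_eq_of_mul_eq_one_right hSS
  -- (G7) in the quotient
  have hrepφ : ∀ q : D.H ≃ₐ[ℚ] D.H, D.TrivialOnL d q → ∃ t ∈ Φ, φ q = φ t ∨ φ q = φ t * φ σ := by
    intro q hq
    obtain ⟨t, ht, h⟩ := hrep q hq
    refine ⟨t, ht, ?_⟩
    rcases h with h | h
    · exact Or.inl ((hφmem _ _).mp h)
    · right; rw [← map_mul]; exact (hφmem _ _).mp h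
  -- the coset space `Q = Φ·⟨σ⟩·Γ` inside the `√−d`-fixing automorphisms
  let Q : Subgroup (D.H ≃ₐ[ℚ] D.H) :=
    { carrier := {x | x (D.sqrtNeg d) = D.sqrtNeg d ∧ ∃ r ∈ Φ, φ x = φ r ∨ φ x = φ r * φ σ}
      mul_mem' := by
        rintro a b ⟨ha, ra, hra, hxa⟩ ⟨hb, rb, hrb, hxb⟩
        refine ⟨by rw [AlgEquiv.mul_apply, hb, ha], ?_⟩
        obtain ⟨r₃, hr₃, h₃⟩ := hrepφ (ra * rb)
          (_root_.Summit.BirchSwinnertonDyer.Rank1Residual.P2.GenusPeriodTransferLayer.trivialOnL_mul D (hΦL ra hra) (hΦL rb hrb))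
        have hBS : φ rb * φ σ = φ σ * φ rb := hφcomm rb σ (hK rb (hΦL rb hrb)) hσK
        -- `φ(ab) = φ(ra rb)` or `φ(ra rb)·φσ`
        have hab : φ (a * b) = φ (ra * rb) ∨ φ (a * b) = φ (ra * rb) * φ σ := by
          rw [map_mul, map_mul]
          rcases hxa with hxa | hxa <;> rcases hxb with hxb | hxb <;> rw [hxa, hxb]
          · exact Or.inl rfl
          · exact Or.inr (mul_assoc _ _ _).symm
          · right
            rw [mul_assoc, ← hBS, ← mul_assoc]
          · left
            calc φ ra * φ σ * (φ rb * φ σ) = φ ra * (φ σ * φ rb) * φ σ := by group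
              _ = φ ra * (φ rb * φ σ) * φ σ := by rw [hBS]
              _ = φ ra * φ rb * (φ σ * φ σ) := by group
              _ = φ ra * φ rb := by rw [hSS, mul_one]
        refine ⟨r₃, hr₃, ?_⟩
        rcases hab with hab | hab <;> rcases h₃ with h₃ | h₃ <;> rw [hab, h₃]
        · exact Or.inl rfl
        · exact Or.inr rfl
        · exact Or.inr rfl
        · left; rw [mul_assoc, hSS, mul_one]
      one_mem' := ⟨rfl, hrepφ 1 (trivialOnL_one D d)⟩
      inv_mem' := by
        rintro a ⟨ha, ra, hra, hxa⟩
        refine ⟨?_, ?_⟩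
        · rw [AlgEquiv.aut_inv]
          calc a.symm (D.sqrtNeg d) = a.symm (a (D.sqrtNeg d)) := by rw [ha]
            _ = D.sqrtNeg d := a.symm_apply_apply _
        · obtain ⟨r', hr', h'⟩ := hrepφ ra⁻¹
            (_root_.Summit.BirchSwinnertonDyer.Rank1Residual.P2.GenusPeriodTransferLayer.trivialOnL_inv D (hΦL ra hra))
          have hAS : φ ra * φ σ = φ σ * φ ra := hφcomm ra σ (hK ra (hΦL ra hra)) hσK
          have hAS' : (φ ra)⁻¹ * φ σ = φ σ * (φ ra)⁻¹ := by
            calc (φ ra)⁻¹ * φ σ = (φ ra)⁻¹ * (φ σ * φ ra) * (φ ra)⁻¹ := by group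
              _ = (φ ra)⁻¹ * (φ ra * φ σ) * (φ ra)⁻¹ := by rw [hAS]
              _ = φ σ * (φ ra)⁻¹ := by group
          -- `φ(a⁻¹) = φ(ra⁻¹)` or `φ(ra⁻¹)·φσ`
          have hinv : φ a⁻¹ = φ ra⁻¹ ∨ φ a⁻¹ = φ ra⁻¹ * φ σ := by
            rw [map_inv, map_inv]
            rcases hxa with hxa | hxa <;> rw [hxa]
            · exact Or.inl rfl
            · right
              rw [mul_inv_rev, hSinv, ← hAS']
          refine ⟨r', hr', ?_⟩
          rcases hinv with hinv | hinv <;> rcases h' with h' | h' <;> rw [hinv, h']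
          · exact Or.inl rfl
          · exact Or.inr rfl
          · exact Or.inr rfl
          · left; rw [mul_assoc, hSS, mul_one] }
  have hQ : ∀ x, x ∈ Q ↔ (x (D.sqrtNeg d) = D.sqrtNeg d ∧ ∃ r ∈ Φ, φ x = φ r ∨ φ x = φ r * φ σ) := fun _ => Iff.rfl
  obtain ⟨t₀, ht₀, h₀⟩ := hrepφ 1 (trivialOnL_one D d)
  rw [map_one] at h₀
  have hΓQ : ΓH' ≤ Q := fun γ hγ => (hQ γ).mpr ⟨hΓK γ hγ, t₀, ht₀, by rw [hφone γ hγ]; exact h₀⟩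
  have hσQ : σ ∈ Q := by
    refine (hQ σ).mpr ⟨hσK, t₀, ht₀, ?_⟩
    rcases h₀ with h₀ | h₀
    · right; rw [← h₀, one_mul]
    · left
      calc φ σ = 1 * φ σ := (one_mul _).symm
        _ = φ t₀ * φ σ * φ σ := by rw [← h₀]
        _ = φ t₀ := by rw [mul_assoc, hSS, mul_one]
  have hΦQ : ∀ t ∈ Φ, t ∈ Q := fun t ht => (hQ t).mpr ⟨hK t (hΦL t ht), t, ht, Or.inl rfl⟩
  have hcommQ : ∀ s ∈ Q, ∀ t ∈ Q, s⁻¹ * t⁻¹ * s * t ∈ ΓH' := fun s hs t ht =>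
    hcomm s t ((hQ s).mp hs).1 ((hQ t).mp ht).1
  have hrepQ : ∀ x ∈ Q, ∃ r ∈ Φ, x * r⁻¹ ∈ ΓH' ∨ x * (r * σ)⁻¹ ∈ ΓH' := by
    intro x hx
    obtain ⟨-, r, hr, h⟩ := (hQ x).mp hx
    refine ⟨r, hr, ?_⟩
    rcases h with h | h
    · exact Or.inl ((hφmem _ _).mpr h)
    · right; rw [hφmem, map_mul]; exact h
  have hgQ : g ∈ Q := (hQ g).mpr ⟨hK g hg, hrepφ g hg⟩
  have key := galPt_sum_dichotomy D Q ΓH' z Φ σ hΓQ hΓn hΓz hcommQ hΦQ hσQ hσσ hσz hrepQ huniq hgQ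
  rw [hZ, ← hcard]
  exact key

/-- **The mover criterion on every CM block** (`d ≡ 5` or `6 (mod 8)`): for `g` trivial on `L_d(i)`, `g·Z(d) ≠ Z(d)` iff
`g^{g(d)} σ⁻¹ ∈ Gal(ℍ′_n/H′_d)`; in that case `g·Z(d) = Z(d) + τ(1)`.
[cite: TianYuanZhang2017, proof of Lemma 3.21 (p0020 L55–L62) and Thm. 3.6 (1)(2) (p0012 L27–L33)] -/
theorem galPt_genusPeriod_ne_iff_of_cmBlockSpec_all {d : ℕ} (hd1 : 1 < d)
    {z : APoint D.H} {Φ : Finset (D.H ≃ₐ[ℚ] D.H)} {ΓH ΓH' : Subgroup (D.H ≃ₐ[ℚ] D.H)} {σ c : D.H ≃ₐ[ℚ] D.H}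
    (h : D.CMBlockSpec d z Φ ΓH ΓH' σ c) {g : D.H ≃ₐ[ℚ] D.H} (hg : D.TrivialOnL d g) :
    (D.galPt g (D.Z d) ≠ D.Z d ↔ g ^ gK d * σ⁻¹ ∈ ΓH') ∧
    (g ^ gK d * σ⁻¹ ∈ ΓH' → D.galPt g (D.Z d) = D.Z d + tauOne) := by
  have hσΓ' : σ ∉ ΓH' := sigma_not_mem D ΓH' z σ h.2.2.1.1 h.2.2.2.2.2.1.2.2
  rcases galPt_genusPeriod_dichotomy_of_cmBlockSpec_all D hd1 h hg with ⟨h1, h2⟩ | ⟨h1, h2⟩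
  · refine ⟨⟨fun hne => absurd h2 hne, fun hm => ?_⟩, fun hm => ?_⟩ <;>
    · exfalso
      apply hσΓ'
      have := ΓH'.mul_mem (ΓH'.inv_mem hm) h1
      rwa [mul_inv_rev, inv_inv, mul_assoc, inv_mul_cancel, mul_one] at this
  · refine ⟨⟨fun _ => h1, fun _ => ?_⟩, fun _ => h2⟩
    rw [h2, Ne, add_eq_left]
    exact tauOne_ne_zero

/-! ## §2 The unified block law for squares on every CM block -/

/-- **Unified block law for squares on every CM block** (`d ≡ 5` or `6 (mod 8)`, `1 < d`):
`g·g·Z(d) = Z(d) + [g(√−d) = √−d ∧ (g·g)^{g(d)} σ⁻¹ ∈ Gal(ℍ′_n/H′_d)]·τ(1)` — if `g` flips `√−d` then `g·g ∈ Gal(ℍ′_n/H′_d)` fixes `Z(d)`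
(g7, (G5)); if `g` fixes `√−d` then `g·g` is trivial on `L_d(i)` and §1 applies.
[cite: TianYuanZhang2017, Prop. 3.2 (1)(2), Thm. 3.6 (1)(2) (p0012 L27–L33), proof of Lemma 3.15 (J750), proof of Lemma 3.21 (p0020 L55–L62)]
[cite: Cox2013, Lemma 9.3] -/
theorem galPt_mul_self_Z_eq_add_ite_all {d : ℕ} (hd : d ∈ n.divisors) (hd1 : 1 < d)
    {z : APoint D.H} {Φ : Finset (D.H ≃ₐ[ℚ] D.H)} {ΓH ΓH' : Subgroup (D.H ≃ₐ[ℚ] D.H)} {σ c : D.H ≃ₐ[ℚ] D.H}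
    (h : D.CMBlockSpec d z Φ ΓH ΓH' σ c) (hc : D.ConjSpec c) (g : D.H ≃ₐ[ℚ] D.H) :
    D.galPt (g * g) (D.Z d) = D.Z d +
      (if g (D.sqrtNeg d) = D.sqrtNeg d ∧ (g * g) ^ gK d * σ⁻¹ ∈ ΓH' then 1 else 0) • (tauOne : APoint D.H) := by
  by_cases hfix : g (D.sqrtNeg d) = D.sqrtNeg d
  · have hL : D.TrivialOnL d (g * g) := trivialOnL_mul_self_of_mem_divisors D g hd
    rcases galPt_genusPeriod_dichotomy_of_cmBlockSpec_all D hd1 h hL with ⟨h1, h2⟩ | ⟨h1, h2⟩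
    · have hσΓ' : σ ∉ ΓH' := sigma_not_mem D ΓH' z σ h.2.2.1.1 h.2.2.2.2.2.1.2.2
      have hnot : ¬ ((g * g) ^ gK d * σ⁻¹ ∈ ΓH') := fun hm => by
        apply hσΓ'
        have := ΓH'.mul_mem (ΓH'.inv_mem hm) h1
        rwa [mul_inv_rev, inv_inv, mul_assoc, inv_mul_cancel, mul_one] at this
      rw [h2, if_neg (fun hh => hnot hh.2), zero_smul, add_zero]
    · rw [h2, if_pos ⟨hfix, h1⟩, one_smul]
  · have hneg : g (D.sqrtNeg d) = -D.sqrtNeg d := (apply_sqrtNeg_eq_or D g hd).resolve_left hfix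
    rw [galPt_mul_self_Z_eq_of_apply_sqrtNeg_eq_neg D hd h hc hneg, if_neg (fun hh => hfix hh.1), zero_smul, add_zero]

/-! ## §3 The genus point of an even `n ≡ 6 (mod 8)` under a square -/

/-- **`g·g·P(n) = P(n) + (ι(n) + Σ_{d ∈ R(n)} |𝓛(n/d)| ι(d) + Σ_{d ∈ R(n)} Σ_{d′ ∈ R(d), d′ ≡ 5} |𝓛(n/d)||𝓛(d/d′)| ι(d′)
+ Σ_{d ∈ R(n) even} Σ_{d′ ∈ R(d)} Σ_{e ∈ R(d′), e ≡ 5} |𝓛(n/d)||𝓛(d/d′)||𝓛(d′/e)| ι(e))·τ(1)`** for EVEN square-free `n ≡ 6 (mod 8)` and ANY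
automorphism `g` of `ℍ′_n`, where `ι(d) := [(d ≡ 5 ∨ d ≡ 6 (mod 8)) ∧ g(√−d) = √−d ∧ (g·g)^{g(d)} σ_d⁻¹ ∈ Gal(ℍ′_n/H′_d)]` is the block
motion of §2 (blocks `d ≡ 7` never move).  Hypotheses: the recursion and the printed CM-point layer on every block (`CMBlockSpec` for
`d ≡ 5, 6`, `SevenBlockSpec` for `d ≡ 7`, one complex conjugation) — the objects of `CMPointGaloisPrinted`, unpacked.  The even companion
of g7's `galPt_mul_self_P_eq_add`. [cite: TianYuanZhang2017, §3.1 (p0011 L53–L73), Prop. 3.2, Thm. 3.6 (1)(2), proof of Lemma 3.21 (p0020 L27–L63)] -/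
theorem galPt_mul_self_P_eq_add_even (hn : Squarefree n) (h6 : n % 8 = 6) (hrec : D.recursion)
    (z : ℕ → APoint D.H) (Φ : ℕ → Finset (D.H ≃ₐ[ℚ] D.H)) (ΓH ΓH' : ℕ → Subgroup (D.H ≃ₐ[ℚ] D.H))
    (σ : ℕ → (D.H ≃ₐ[ℚ] D.H)) (c : D.H ≃ₐ[ℚ] D.H) (hc : D.ConjSpec c)
    (hblock : ∀ d ∈ n.divisors, ((d % 8 = 5 ∨ d % 8 = 6) → D.CMBlockSpec d (z d) (Φ d) (ΓH d) (ΓH' d) (σ d) c) ∧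
      (d % 8 = 7 → D.SevenBlockSpec d))
    (g : D.H ≃ₐ[ℚ] D.H) :
    D.galPt (g * g) (D.P n) = D.P n +
      ((if (n % 8 = 5 ∨ n % 8 = 6) ∧ g (D.sqrtNeg n) = D.sqrtNeg n ∧ (g * g) ^ gK n * (σ n)⁻¹ ∈ ΓH' n then 1 else 0) +
        ∑ d ∈ recursionIndex n, (D.scriptL (n / d)).natAbs *
          (if (d % 8 = 5 ∨ d % 8 = 6) ∧ g (D.sqrtNeg d) = D.sqrtNeg d ∧ (g * g) ^ gK d * (σ d)⁻¹ ∈ ΓH' d then 1 else 0) +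
        ∑ d ∈ recursionIndex n, ∑ d' ∈ (recursionIndex d).filter (fun d' => d' % 8 = 5),
          (D.scriptL (n / d)).natAbs * (D.scriptL (d / d')).natAbs *
            (if (d' % 8 = 5 ∨ d' % 8 = 6) ∧ g (D.sqrtNeg d') = D.sqrtNeg d' ∧ (g * g) ^ gK d' * (σ d')⁻¹ ∈ ΓH' d' then 1 else 0) +
        ∑ d ∈ (recursionIndex n).filter (fun d => d % 2 = 0), ∑ d' ∈ recursionIndex d,
          ∑ e ∈ (recursionIndex d').filter (fun e => e % 8 = 5),
            (D.scriptL (n / d)).natAbs * (D.scriptL (d / d')).natAbs * (D.scriptL (d' / e)).natAbs *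
              (if (e % 8 = 5 ∨ e % 8 = 6) ∧ g (D.sqrtNeg e) = D.sqrtNeg e ∧ (g * g) ^ gK e * (σ e)⁻¹ ∈ ΓH' e then 1 else 0))
        • tauOne := by
  refine galPt_P_eq_add_moebius_even D hn h6 hrec (g * g) (mul_self_apply_im D g)
    (fun d => if (d % 8 = 5 ∨ d % 8 = 6) ∧ g (D.sqrtNeg d) = D.sqrtNeg d ∧ (g * g) ^ gK d * (σ d)⁻¹ ∈ ΓH' d then 1 else 0) ?_
  intro d hd hd8
  rcases hd8 with h5 | h6' | h7
  · have hd1 : 1 < d := by omega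
    rw [galPt_mul_self_Z_eq_add_ite_all D hd hd1 ((hblock d hd).1 (Or.inl h5)) hc g]
    by_cases hh : g (D.sqrtNeg d) = D.sqrtNeg d ∧ (g * g) ^ gK d * (σ d)⁻¹ ∈ ΓH' d
    · rw [if_pos hh, if_pos ⟨Or.inl h5, hh⟩]
    · rw [if_neg hh, if_neg (fun hh' => hh hh'.2)]
  · have hd1 : 1 < d := by omega
    rw [galPt_mul_self_Z_eq_add_ite_all D hd hd1 ((hblock d hd).1 (Or.inr h6')) hc g]
    by_cases hh : g (D.sqrtNeg d) = D.sqrtNeg d ∧ (g * g) ^ gK d * (σ d)⁻¹ ∈ ΓH' d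
    · rw [if_pos hh, if_pos ⟨Or.inr h6', hh⟩]
    · rw [if_neg hh, if_neg (fun hh' => hh hh'.2)]
  · have hd1 : 1 < d := by omega
    rw [galPt_mul_self_Z_eq_of_sevenBlockSpec D hd hd1 ((hblock d hd).2 h7) g, if_neg (fun hh => by omega), zero_smul, add_zero]

/-- **Mover criterion for squares, even `n ≡ 6 (mod 8)`**: under the hypotheses of `galPt_mul_self_P_eq_add_even`, `g·g` MOVES `P(n)` iff the
displayed integer (block motions `ι` weighted along the surviving chains of the recursion) is ODD.
[cite: TianYuanZhang2017, §3.1 (p0011 L53–L73) and proof of Lemma 3.21 (p0020 L27–L63)] -/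
theorem galPt_mul_self_P_ne_iff_even (hn : Squarefree n) (h6 : n % 8 = 6) (hrec : D.recursion)
    (z : ℕ → APoint D.H) (Φ : ℕ → Finset (D.H ≃ₐ[ℚ] D.H)) (ΓH ΓH' : ℕ → Subgroup (D.H ≃ₐ[ℚ] D.H))
    (σ : ℕ → (D.H ≃ₐ[ℚ] D.H)) (c : D.H ≃ₐ[ℚ] D.H) (hc : D.ConjSpec c)
    (hblock : ∀ d ∈ n.divisors, ((d % 8 = 5 ∨ d % 8 = 6) → D.CMBlockSpec d (z d) (Φ d) (ΓH d) (ΓH' d) (σ d) c) ∧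
      (d % 8 = 7 → D.SevenBlockSpec d))
    (g : D.H ≃ₐ[ℚ] D.H) :
    D.galPt (g * g) (D.P n) ≠ D.P n ↔
      Odd ((if (n % 8 = 5 ∨ n % 8 = 6) ∧ g (D.sqrtNeg n) = D.sqrtNeg n ∧ (g * g) ^ gK n * (σ n)⁻¹ ∈ ΓH' n then 1 else 0) +
        ∑ d ∈ recursionIndex n, (D.scriptL (n / d)).natAbs *
          (if (d % 8 = 5 ∨ d % 8 = 6) ∧ g (D.sqrtNeg d) = D.sqrtNeg d ∧ (g * g) ^ gK d * (σ d)⁻¹ ∈ ΓH' d then 1 else 0) +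
        ∑ d ∈ recursionIndex n, ∑ d' ∈ (recursionIndex d).filter (fun d' => d' % 8 = 5),
          (D.scriptL (n / d)).natAbs * (D.scriptL (d / d')).natAbs *
            (if (d' % 8 = 5 ∨ d' % 8 = 6) ∧ g (D.sqrtNeg d') = D.sqrtNeg d' ∧ (g * g) ^ gK d' * (σ d')⁻¹ ∈ ΓH' d' then 1 else 0) +
        ∑ d ∈ (recursionIndex n).filter (fun d => d % 2 = 0), ∑ d' ∈ recursionIndex d,
          ∑ e ∈ (recursionIndex d').filter (fun e => e % 8 = 5),
            (D.scriptL (n / d)).natAbs * (D.scriptL (d / d')).natAbs * (D.scriptL (d' / e)).natAbs *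
              (if (e % 8 = 5 ∨ e % 8 = 6) ∧ g (D.sqrtNeg e) = D.sqrtNeg e ∧ (g * g) ^ gK e * (σ e)⁻¹ ∈ ΓH' e then 1 else 0)) := by
  rw [galPt_mul_self_P_eq_add_even D hn h6 hrec z Φ ΓH ΓH' σ c hc hblock g, Ne, add_eq_left, nsmul_tauOne_eq_mod_two]
  constructor
  · intro h
    rw [Nat.odd_iff]
    by_contra h1
    have h0 : _ % 2 = 0 := (Nat.mod_two_eq_zero_or_one _).resolve_right h1
    exact h (by rw [h0, zero_smul])
  · intro h
    rw [Nat.odd_iff.mp h, one_smul]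
    exact tauOne_ne_zero

end Summit.BirchSwinnertonDyer.PrintCf2.MoverAssembly

end
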